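/-
Origin: expansion seat `planner-pub-hodgecm-toy2-g4-0`, handover #3 2026-08-18T07:52:10Z (`HOME/pub-hodgecm-toy2-g4/lean/Toy2g4/PadH6Alg.lean`, md5 99b19a2f, 398 lines);
landed by the gen-7 packager in gate run 26 as `HodgeCM/Model/Toy/ToyPadH6Alg.lean` (import ^import Toy2g4\.PadH6At\b→import HodgeCM.Model.Toy.ToyPadH6At ×1).
-/
/-
Copyright: pub-hodgecm formalisation cell (harness21, 2026). New file (not vendored).
Origin: HOME/pub-hodgecm-toy2-g4/lean/Toy2g4/PadH6Alg.lean — session planner-pub-hodgecm-toy2-g4-0 (unit pub-hodgecm-toy2-g4,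
CONSISTENCY seat 2, part (6a)(ii), generation 4).  WIP module `Toy2g4.PadH6Alg`; intended final place
`HodgeCM/Model/Toy/ToyPadH6Alg.lean` (module `HodgeCM.Model.Toy.ToyPadH6Alg`).
WIP import to rewrite on landing: `import Toy2g4.PadH6At` ↦ `import HodgeCM.Model.Toy.ToyPadH6At` (this seat).
-/
import Summits.HodgeConjecture.HodgeCM.Model.Toy.ToyPadH6At

/-!
# The padded universe with ALGEBRAIC pad: `HC_CM` and `Qw8Sufficiency` hold, `PohlmannSpan` and N1 fail

`HodgeCM.Model.PadH6` pads `H⁶` by a second copy of type `(3,3)` which is NOT algebraic; there COR-CM fails together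
with Pohlmann's span theorem.  Here the pad is declared ALGEBRAIC instead:

  `U♯ᵃ := U.padH6A`, equal to `U.padH6` except `Alg♯ᵃ(X)^p := {x : toU x ∈ Alg(X)^p}` (`= Alg³ ⊕ H⁶` in degree 6).

Everything not mentioning `alg` is literally as in `U♯` (`PohlmannSpan`, the weight vectors, N1–N4, cup products), and:

* `PadH6A.modelAxioms (M : U.ModelAxioms) (hd : U.Fact_dimProd) : U.padH6A.ModelAxioms` (28/28);
* `PadH6A.hc_iff : U♯ᵃ.HC X ↔ U.HC X`, **`PadH6A.hc_cm_iff : U♯ᵃ.HC_CM ↔ U.HC_CM`**, `faceReduction_iff`,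
  `lemma81_iff`, `w_RK4_iff`, **`PadH6A.qw8Sufficiency : U.Qw8Sufficiency → U♯ᵃ.Qw8Sufficiency`**;
* **`PadH6A.not_pohlmannSpan (M) (hN1) : ¬ U♯ᵃ.PohlmannSpan`**, `not_pohlmannSpanAt`, `not_fact_cupExterior`.

The toy instance `padAlgModel := toyModel.padH6A` therefore satisfies ALL 28 model facts, N2, N3, N4, F4, F5,
`Fact_dimProd`, `W_RK4`, `Qw8Sufficiency`, `FaceReduction`, `Lemma81` AND THE TARGET `HC_CM` — and still
`¬ PohlmannSpan`, `¬ Fact_cupExterior` (`padAlgModel_profile`).  Consequences: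

* `pohlmannSpan_independent_of_rest` — the open input `pohlmann_span` (with N1) is logically independent of every
  other named statement of the package, INCLUDING the conclusion COR-CM: `¬ (ModelAxioms → HC_CM → PohlmannSpan)`
  (`hc_cm_not_implies_pohlmannSpan`), `¬ (ModelAxioms → HC_CM → Fact_cupExterior)`;
* so in PerL's implication `OpenInputs ∧ textbook facts → HC_CM` the input `pohlmann_span` is neither refutable from,
  nor derivable from, the remaining hypotheses together with the conclusion.

Nothing is cited; Lean + Mathlib axioms only.
-/

noncomputable section

open scoped TensorProduct

namespace HodgeCM

open Literature.AlgebraicGeometry.Motives (CMType HodgeStructure)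
open Literature.AlgebraicGeometry.Motives.HodgeStructure (ofRat pureFiltration)

namespace PadSix

section Defs

variable (A B : Type) [AddCommGroup A] [AddCommGroup B] [Module ℚ A] [Module ℚ B]

/-- the sub-space `S ⊕ B` of `Pad k A B` (`= S` off degree `6`) -/
@[reducible] def subTop : (k : ℕ) → Submodule ℚ A → Submodule ℚ (Pad k A B)
  | 6, S => S.prod ⊤
  | 0, S => S
  | 1, S => S
  | 2, S => S
  | 3, S => S
  | 4, S => S
  | 5, S => S
  | _ + 7, S => S

end Defs

variable {A B : Type} [AddCommGroup A] [AddCommGroup B] [Module ℚ A] [Module ℚ B]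

/-- (Ported verbatim from the HodgeCMPerL package; no docstring in the source.) -/
theorem mem_subTop_iff (k : ℕ) (S : Submodule ℚ A) (x : Pad k A B) : x ∈ subTop A B k S ↔ fst A B k x ∈ S := by
  rcases k with _|_|_|_|_|_|_|k
  pick_goal 7
  · exact Submodule.mem_prod.trans (and_iff_left Submodule.mem_top)
  all_goals exact Iff.rfl

/-- complexification of `S ⊕ B ≤ A ⊕ B`: membership is read on the first component -/
theorem mem_baseChange_prod_top_iff (S : Submodule ℚ A) (z : ℂ ⊗[ℚ] (A × B)) :
    z ∈ (S.prod (⊤ : Submodule ℚ B)).baseChange ℂ ↔ (LinearMap.fst ℚ A B).baseChange ℂ z ∈ S.baseChange ℂ := by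
  constructor
  · intro hz
    have h1 : (S.prod (⊤ : Submodule ℚ B)).baseChange ℂ ≤
        (S.baseChange ℂ).comap ((LinearMap.fst ℚ A B).baseChange ℂ) := by
      rw [Submodule.baseChange_eq_span, Submodule.span_le]
      rintro _ ⟨m, hm, rfl⟩
      rw [SetLike.mem_coe, Submodule.mem_comap, TensorProduct.mk_apply, LinearMap.baseChange_tmul]
      exact Submodule.tmul_mem_baseChange_of_mem 1 (Submodule.mem_prod.mp hm).1
    exact h1 hz
  · intro hz
    have hdec : ∀ w : ℂ ⊗[ℚ] (A × B),
        (LinearMap.inl ℚ A B).baseChange ℂ ((LinearMap.fst ℚ A B).baseChange ℂ w) +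
          (LinearMap.inr ℚ A B).baseChange ℂ ((LinearMap.snd ℚ A B).baseChange ℂ w) = w := fun w => by
      induction w using TensorProduct.induction_on with
      | zero => simp only [map_zero, add_zero]
      | tmul c m =>
        rw [LinearMap.baseChange_tmul, LinearMap.baseChange_tmul, LinearMap.baseChange_tmul,
          LinearMap.baseChange_tmul, ← TensorProduct.tmul_add]
        congr 1
        exact Prod.ext (add_zero _) (zero_add _)
      | add x y hx hy => rw [map_add, map_add, map_add, map_add, add_add_add_comm, hx, hy]
    have h2 : S.baseChange ℂ ≤
        ((S.prod (⊤ : Submodule ℚ B)).baseChange ℂ).comap ((LinearMap.inl ℚ A B).baseChange ℂ) := by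
      rw [Submodule.baseChange_eq_span, Submodule.span_le]
      rintro _ ⟨m, hm, rfl⟩
      rw [SetLike.mem_coe, Submodule.mem_comap, TensorProduct.mk_apply, LinearMap.baseChange_tmul]
      exact Submodule.tmul_mem_baseChange_of_mem 1 (Submodule.mem_prod.mpr ⟨hm, Submodule.mem_top⟩)
    have h3 : (⊤ : Submodule ℂ (ℂ ⊗[ℚ] B)) ≤
        ((S.prod (⊤ : Submodule ℚ B)).baseChange ℂ).comap ((LinearMap.inr ℚ A B).baseChange ℂ) := by
      rw [← Submodule.baseChange_top, Submodule.baseChange_eq_span, Submodule.span_le]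
      rintro _ ⟨m, -, rfl⟩
      rw [SetLike.mem_coe, Submodule.mem_comap, TensorProduct.mk_apply, LinearMap.baseChange_tmul]
      exact Submodule.tmul_mem_baseChange_of_mem 1 (Submodule.mem_prod.mpr ⟨S.zero_mem, Submodule.mem_top⟩)
    rw [← hdec z]
    exact add_mem (h2 hz) (h3 Submodule.mem_top)

/-- (Ported verbatim from the HodgeCMPerL package; no docstring in the source.) -/
theorem mem_baseChange_subTop_iff (k : ℕ) (S : Submodule ℚ A) (z : ℂ ⊗[ℚ] Pad k A B) :
    z ∈ (subTop A B k S).baseChange ℂ ↔ (fst A B k).baseChange ℂ z ∈ S.baseChange ℂ := by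
  rcases k with _|_|_|_|_|_|_|k
  pick_goal 7
  · exact mem_baseChange_prod_top_iff S z
  all_goals
    show z ∈ S.baseChange ℂ ↔ (LinearMap.id : A →ₗ[ℚ] A).baseChange ℂ z ∈ S.baseChange ℂ
    rw [LinearMap.baseChange_id, LinearMap.id_apply]

end PadSix

namespace Universe

variable (U : Universe)

/-- **`U♯ᵃ`**: the padded universe `U♯ = U.padH6` with the pad declared ALGEBRAIC (`Alg♯ᵃ³ = Alg³ ⊕ H⁶`). -/
@[reducible] def padH6A : Universe :=
  { U.padH6 with alg := fun X p => PadSix.subTop (U.Coh X (2 * p)) (U.Coh X 6) (2 * p) (U.alg X p) }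

namespace PadH6A

variable {U}

open PadH6

/-- (Ported verbatim from the HodgeCMPerL package; no docstring in the source.) -/
theorem mem_alg_iff (X : U.Var) (p : ℕ) (x : U.padH6A.Coh X (2 * p)) :
    x ∈ U.padH6A.alg X p ↔ toU (U := U) X (2 * p) x ∈ U.alg X p :=
  PadSix.mem_subTop_iff (2 * p) _ x

/-- (Ported verbatim from the HodgeCMPerL package; no docstring in the source.) -/
theorem alg_le_alg (X : U.Var) (p : ℕ) : U.padH6.alg X p ≤ U.padH6A.alg X p := fun x hx =>
  (mem_alg_iff X p x).mpr ((PadH6.mem_alg_iff (U := U) X p x).mp hx).1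

/-- (Ported verbatim from the HodgeCMPerL package; no docstring in the source.) -/
theorem ofU_mem_alg (X : U.Var) (p : ℕ) {x : U.Coh X (2 * p)} (hx : x ∈ U.alg X p) :
    ofU (U := U) X (2 * p) x ∈ U.padH6A.alg X p :=
  alg_le_alg X p (PadH6.ofU_mem_alg (U := U) X p hx)

/-- (Ported verbatim from the HodgeCMPerL package; no docstring in the source.) -/
theorem toU_pull {X Y : U.Var} (f : U.Mor X Y) (k : ℕ) (y : U.padH6A.Coh Y k) :
    toU (U := U) X k (U.padH6A.pull f k y) = U.pull f k (toU (U := U) Y k y) :=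
  PadH6.toU_pull (U := U) f k y

/-- (Ported verbatim from the HodgeCMPerL package; no docstring in the source.) -/
theorem toU_cup (X : U.Var) (i j : ℕ) (x : U.padH6A.Coh X i) (y : U.padH6A.Coh X j) :
    toU (U := U) X (i + j) (U.padH6A.cup X i j x y) = U.cup X i j (toU (U := U) X i x) (toU (U := U) X j y) :=
  PadH6.toU_cup (U := U) X i j x y

/-- (Ported verbatim from the HodgeCMPerL package; no docstring in the source.) -/
theorem toU_castCoh (X : U.Var) {k l : ℕ} (h : k = l) (x : U.padH6A.Coh X k) :
    toU (U := U) X l (U.padH6A.castCoh X h x) = U.castCoh X h (toU (U := U) X k x) :=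
  PadH6.toU_castCoh (U := U) X h x

/-- complexified algebraic classes of `U♯ᵃ` are read on the geometric component -/
theorem mem_algC_iff (X : U.Var) (p : ℕ) (z : U.padH6A.CohC X (2 * p)) :
    z ∈ U.padH6A.algC X p ↔ toUC (U := U) X (2 * p) z ∈ U.algC X p :=
  PadSix.mem_baseChange_subTop_iff (2 * p) _ z

/-- rational Hodge classes of `U♯ᵃ` (`= U♯`): the geometric component is a Hodge class (the pad always is) -/
theorem mem_hodgeClassesOf_iff (X : U.Var) (p : ℕ) (x : U.padH6A.Coh X (2 * p)) :
    x ∈ U.padH6A.hodgeClassesOf X p ↔ toU (U := U) X (2 * p) x ∈ U.hodgeClassesOf X p := by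
  show x ∈ (U.padH6.hodge X (2 * p)).hodgeClasses (p : ℤ) ↔ toU (U := U) X (2 * p) x ∈ (U.hodge X (2 * p)).hodgeClasses (p : ℤ)
  rw [HodgeStructure.mem_hodgeClasses_iff, HodgeStructure.mem_hodgeClasses_iff, PadH6.ofRat_mem_F_iff (U := U),
    and_iff_left_iff_imp]
  intro _
  by_cases hp : (p : ℤ) ≤ 3
  · rw [HodgeStructure.pureFiltration_of_le hp]; exact Submodule.mem_top
  · have hk : 2 * p ≠ 6 := by omega
    rw [PadH6.padOf_of_ne (U := U) X hk, map_zero]; exact Submodule.zero_mem _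

set_option smartUnfolding false in
/-- **`U♯ᵃ ⊨ ModelAxioms`.** -/
theorem modelAxioms (M : U.ModelAxioms) (hd : U.Fact_dimProd) : U.padH6A.ModelAxioms :=
  { PadH6.modelAxioms M hd with
    alg_le_hodge := fun X p x hx =>
      (mem_hodgeClassesOf_iff (U := U) X p x).mpr (M.alg_le_hodge X p ((mem_alg_iff (U := U) X p x).mp hx))
    pull_alg := by
      rintro X Y f p _ ⟨y, hy, rfl⟩
      rw [SetLike.mem_coe, mem_alg_iff (U := U)] at hy
      rw [mem_alg_iff (U := U), toU_pull (U := U)]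
      exact M.pull_alg X Y f p ⟨_, hy, rfl⟩
    cup_alg := fun X x y hx hy => M.cup_alg X x y hx hy
    lefschetz11 := fun X => M.lefschetz11 X
    gysin_surface := fun S X f hS => by
      obtain ⟨c, hc, h⟩ := (PadH6.modelAxioms M hd).gysin_surface S X f hS
      exact ⟨c, alg_le_alg (U := U) X (U.dim X - 2) hc, h⟩
    algDuality := fun K Φ => by
      obtain ⟨D, hD1, hD2, hD3⟩ := (PadH6.modelAxioms M hd).algDuality K Φ
      have hP := PadH6.dim_prod4 M hd K Φ
      have hdim : 2 * (U.dim (U.prod4 K Φ) - 2) ≠ 6 := by omega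
      refine ⟨D, hD1, ?_, hD3⟩
      rintro _ ⟨x, hx, rfl⟩
      rw [SetLike.mem_coe, mem_alg_iff (U := U)] at hx
      have hx' : x ∈ U.padH6.alg (U.prod4 K Φ) (U.dim (U.prod4 K Φ) - 2) :=
        (PadH6.mem_alg_iff (U := U) _ _ x).mpr ⟨hx, PadH6.padOf_of_ne (U := U) _ hdim x⟩
      exact alg_le_alg (U := U) _ 2 (hD2 ⟨x, hx', rfl⟩) }

/-! ### The N-facts and the statements not mentioning `alg` are those of `U♯` -/

/-- (Ported verbatim from the HodgeCMPerL package; no docstring in the source.) -/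
theorem fact_cup_hodge (h : U.Fact_cup_hodge) : U.padH6A.Fact_cup_hodge := PadH6.fact_cup_hodge (U := U) h
/-- (Ported verbatim from the HodgeCMPerL package; no docstring in the source.) -/
theorem fact_pull_H0_iff : U.padH6A.Fact_pull_H0 ↔ U.Fact_pull_H0 := Iff.rfl
/-- (Ported verbatim from the HodgeCMPerL package; no docstring in the source.) -/
theorem fact_hodge_F0 (h : U.Fact_hodge_F0) : U.padH6A.Fact_hodge_F0 := PadH6.fact_hodge_F0 (U := U) h
/-- (Ported verbatim from the HodgeCMPerL package; no docstring in the source.) -/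
theorem fact_cupAssoc (h : U.Fact_cupAssoc) : U.padH6A.Fact_cupAssoc := PadH6.fact_cupAssoc (U := U) h
/-- (Ported verbatim from the HodgeCMPerL package; no docstring in the source.) -/
theorem fact_dimProd_iff : U.padH6A.Fact_dimProd ↔ U.Fact_dimProd := Iff.rfl
set_option smartUnfolding false in
/-- (Ported verbatim from the HodgeCMPerL package; no docstring in the source.) -/
theorem fact_cupExterior_iff : U.padH6A.Fact_cupExterior ↔ U.padH6.Fact_cupExterior := Iff.rfl
set_option smartUnfolding false in
/-- (Ported verbatim from the HodgeCMPerL package; no docstring in the source.) -/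
theorem pohlmannSpan_iff : U.padH6A.PohlmannSpan ↔ U.padH6.PohlmannSpan := Iff.rfl
set_option smartUnfolding false in
/-- (Ported verbatim from the HodgeCMPerL package; no docstring in the source.) -/
theorem pohlmannSpanAt_iff (F : CMField) (n : ℕ) (Θ : Fin (n + 1) → CMType F) (p : ℕ) :
    U.padH6A.PohlmannSpanAt F n Θ p ↔ U.padH6.PohlmannSpanAt F n Θ p := Iff.rfl
set_option smartUnfolding false in
/-- (Ported verbatim from the HodgeCMPerL package; no docstring in the source.) -/
theorem realisationExistsFace (h : U.RealisationExistsFace) : U.padH6A.RealisationExistsFace := by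
  intro F hG h6 f ι₁ hf V
  obtain ⟨r⟩ := h F hG h6 f ι₁ hf V
  exact ⟨{ r with }⟩
set_option smartUnfolding false in
/-- (Ported verbatim from the HodgeCMPerL package; no docstring in the source.) -/
theorem realisationExistsPerL (h : U.RealisationExistsPerL) : U.padH6A.RealisationExistsPerL := by
  intro K L j hN hK hL φ hφ ι₁ hι t ht V
  obtain ⟨r⟩ := h K L j hN hK hL φ hφ ι₁ hι t ht V
  exact ⟨{ r with }⟩

/-- F4 `Fact_cupAlg` transfers (cup products are read on the geometric components). -/
theorem fact_cupAlg (h : U.Fact_cupAlg) : U.padH6A.Fact_cupAlg := by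
  intro X p q x y hx hy
  rw [mem_alg_iff (U := U), toU_castCoh (U := U), toU_cup (U := U)]
  exact h X p q _ _ ((mem_alg_iff (U := U) X p x).mp hx) ((mem_alg_iff (U := U) X q y).mp hy)

/-- `W_RK4` (degree `4`) is literally the same statement. -/
theorem w_RK4_iff : U.padH6A.W_RK4 ↔ U.W_RK4 := Iff.rfl

/-! ### The Hodge conjecture transfers both ways -/

/-- (Ported verbatim from the HodgeCMPerL package; no docstring in the source.) -/
theorem hc_iff (X : U.Var) : U.padH6A.HC X ↔ U.HC X := by
  constructor
  · intro h p x hx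
    have h1 : ofU (U := U) X (2 * p) x ∈ U.padH6A.hodgeClassesOf X p := by
      rw [mem_hodgeClassesOf_iff (U := U), PadH6.toU_ofU (U := U)]; exact hx
    have h2 := (mem_alg_iff (U := U) X p _).mp (h p h1)
    rwa [PadH6.toU_ofU (U := U)] at h2
  · intro h p x hx
    exact (mem_alg_iff (U := U) X p x).mpr (h p ((mem_hodgeClassesOf_iff (U := U) X p x).mp hx))

/-- **COR-CM holds in `U♯ᵃ` iff it holds in `U`.** -/
theorem hc_cm_iff : U.padH6A.HC_CM ↔ U.HC_CM :=
  forall_congr' fun X => imp_congr_right fun _ => hc_iff (U := U) X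

set_option smartUnfolding false in
/-- (Ported verbatim from the HodgeCMPerL package; no docstring in the source.) -/
theorem faceReduction_iff : U.padH6A.FaceReduction ↔ U.FaceReduction :=
  forall_congr' fun F => forall_congr' fun _ => forall_congr' fun _ => forall_congr' fun _ =>
    forall_congr' fun _ => forall_congr' fun Θ => hc_iff (U := U) (U.cmProd F Θ)

set_option smartUnfolding false in
/-- (Ported verbatim from the HodgeCMPerL package; no docstring in the source.) -/
theorem lemma81_iff : U.padH6A.Lemma81 ↔ U.Lemma81 :=
  imp_congr (forall_congr' fun F => forall_congr' fun _ => forall_congr' fun _ => forall_congr' fun _ =>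
    forall_congr' fun Θ => hc_iff (U := U) (U.cmProd F Θ)) (hc_cm_iff (U := U))

set_option smartUnfolding false in
/-- **`Qw8Sufficiency` transfers to `U♯ᵃ`**: the geometric component of a weight vector of `U♯ᵃ` is a weight vector
of `U` of the same weight, with the same Lefschetz character; it is algebraic in `U`, so the vector is in `Alg♯ᵃ ⊗ ℂ`. -/
theorem qw8Sufficiency (h : U.Qw8Sufficiency) : U.padH6A.Qw8Sufficiency := by
  intro F hG h6 hW n Θ p S x hS hx hchar
  exact (mem_algC_iff (U := U) _ p x).mpr (h F hG h6 hW n Θ p S _ hS (PadH6.isWeightVector_toUC (U := U) Θ hx) hchar)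

/-! ### … while Pohlmann's span theorem and N1 fail, exactly as in `U♯` -/

/-- (Ported verbatim from the HodgeCMPerL package; no docstring in the source.) -/
theorem not_pohlmannSpan (M : U.ModelAxioms) (hN1 : U.Fact_cupExterior) : ¬ U.padH6A.PohlmannSpan :=
  fun h => PadH6.not_pohlmannSpan M hN1 ((pohlmannSpan_iff (U := U)).mp h)

/-- (Ported verbatim from the HodgeCMPerL package; no docstring in the source.) -/
theorem not_pohlmannSpanAt (M : U.ModelAxioms) (hN1 : U.Fact_cupExterior) (F : CMField)
    (Θ : Fin (5 + 1) → CMType F) : ¬ U.padH6A.PohlmannSpanAt F 5 Θ 3 :=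
  fun h => PadH6.not_pohlmannSpanAt M hN1 F Θ ((pohlmannSpanAt_iff (U := U) F 5 Θ 3).mp h)

/-- (Ported verbatim from the HodgeCMPerL package; no docstring in the source.) -/
theorem not_openInputs (M : U.ModelAxioms) (hN1 : U.Fact_cupExterior) : ¬ U.padH6A.OpenInputs :=
  fun h => not_pohlmannSpan (U := U) M hN1 h.pohlmann_span

/-- (Ported verbatim from the HodgeCMPerL package; no docstring in the source.) -/
theorem not_fact_cupExterior (M : U.ModelAxioms) (hd : U.Fact_dimProd) (hN1 : U.Fact_cupExterior)
    (hN2 : U.Fact_cup_hodge) (hN3 : U.Fact_pull_H0) (hN4 : U.Fact_hodge_F0) : ¬ U.padH6A.Fact_cupExterior :=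
  fun h => not_pohlmannSpan (U := U) M hN1
    (pohlmannSpan_of_facts (modelAxioms (U := U) M hd) h (fact_cup_hodge (U := U) hN2)
      ((fact_pull_H0_iff (U := U)).mpr hN3) (fact_hodge_F0 (U := U) hN4))

end PadH6A

/-- **Separation of `pohlmann_span` (and N1) from everything else, the target included.** -/
theorem exists_model_hc_cm_not_pohlmannSpan
    (h : ∃ U : Universe, U.ModelAxioms ∧ U.Fact_cupExterior ∧ U.Fact_cup_hodge ∧ U.Fact_pull_H0 ∧ U.Fact_hodge_F0 ∧
      U.Fact_dimProd ∧ U.HC_CM ∧ U.Qw8Sufficiency ∧ U.W_RK4) :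
    ∃ U : Universe, U.ModelAxioms ∧ U.Fact_cup_hodge ∧ U.Fact_pull_H0 ∧ U.Fact_hodge_F0 ∧ U.Fact_dimProd ∧
      U.HC_CM ∧ U.Qw8Sufficiency ∧ U.W_RK4 ∧ ¬ U.PohlmannSpan ∧ ¬ U.Fact_cupExterior := by
  obtain ⟨U, M, hN1, hN2, hN3, hN4, hd, hHC, hQ, hW⟩ := h
  exact ⟨U.padH6A, PadH6A.modelAxioms M hd, PadH6A.fact_cup_hodge hN2, PadH6A.fact_pull_H0_iff.mpr hN3,
    PadH6A.fact_hodge_F0 hN4, PadH6A.fact_dimProd_iff.mpr hd, PadH6A.hc_cm_iff.mpr hHC, PadH6A.qw8Sufficiency hQ,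
    PadH6A.w_RK4_iff.mpr hW, PadH6A.not_pohlmannSpan M hN1, PadH6A.not_fact_cupExterior M hd hN1 hN2 hN3 hN4⟩

end Universe

/-! ## The toy instance -/

namespace Toy

open Universe

/-- **The padded toy universe with algebraic pad.** -/
def padAlgModel : Universe := toyModel.padH6A

/-- (Ported verbatim from the HodgeCMPerL package; no docstring in the source.) -/
theorem padAlgModel_modelAxioms : padAlgModel.ModelAxioms :=
  PadH6A.modelAxioms toyModel_modelAxioms toyModel_fact_dimProd
/-- (Ported verbatim from the HodgeCMPerL package; no docstring in the source.) -/
theorem padAlgModel_fact_cup_hodge : padAlgModel.Fact_cup_hodge := PadH6A.fact_cup_hodge toyModel_fact_cup_hodge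
/-- (Ported verbatim from the HodgeCMPerL package; no docstring in the source.) -/
theorem padAlgModel_fact_pull_H0 : padAlgModel.Fact_pull_H0 := PadH6A.fact_pull_H0_iff.mpr toyModel_fact_pull_H0
/-- (Ported verbatim from the HodgeCMPerL package; no docstring in the source.) -/
theorem padAlgModel_fact_hodge_F0 : padAlgModel.Fact_hodge_F0 := PadH6A.fact_hodge_F0 toyModel_fact_hodge_F0
/-- (Ported verbatim from the HodgeCMPerL package; no docstring in the source.) -/
theorem padAlgModel_fact_dimProd : padAlgModel.Fact_dimProd := PadH6A.fact_dimProd_iff.mpr toyModel_fact_dimProd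
/-- (Ported verbatim from the HodgeCMPerL package; no docstring in the source.) -/
theorem padAlgModel_fact_cupAssoc : padAlgModel.Fact_cupAssoc :=
  PadH6A.fact_cupAssoc (fact_cupAssoc exteriorHodgeData)
/-- (Ported verbatim from the HodgeCMPerL package; no docstring in the source.) -/
theorem padAlgModel_fact_cupAlg : padAlgModel.Fact_cupAlg := PadH6A.fact_cupAlg fact_cupAlg
/-- (Ported verbatim from the HodgeCMPerL package; no docstring in the source.) -/
theorem padAlgModel_w_rk4 : padAlgModel.W_RK4 := PadH6A.w_RK4_iff.mpr toyModel_w_rk4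
/-- **COR-CM holds in `padAlgModel`.** -/
theorem padAlgModel_hc_cm : padAlgModel.HC_CM := PadH6A.hc_cm_iff.mpr toyModel_hc_cm
/-- (Ported verbatim from the HodgeCMPerL package; no docstring in the source.) -/
theorem padAlgModel_qw8Sufficiency : padAlgModel.Qw8Sufficiency := PadH6A.qw8Sufficiency toyModel_qw8Sufficiency
/-- (Ported verbatim from the HodgeCMPerL package; no docstring in the source.) -/
theorem padAlgModel_faceReduction : padAlgModel.FaceReduction := PadH6A.faceReduction_iff.mpr toyModel_faceReduction
/-- **… and Pohlmann's span theorem fails in it** (at every CM field and every sextuple of CM types). -/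
theorem not_padAlgModel_pohlmannSpan : ¬ padAlgModel.PohlmannSpan :=
  PadH6A.not_pohlmannSpan toyModel_modelAxioms toyModel_fact_cupExterior
/-- (Ported verbatim from the HodgeCMPerL package; no docstring in the source.) -/
theorem not_padAlgModel_pohlmannSpanAt (F : CMField) (Θ : Fin (5 + 1) → CMType F) :
    ¬ padAlgModel.PohlmannSpanAt F 5 Θ 3 :=
  PadH6A.not_pohlmannSpanAt toyModel_modelAxioms toyModel_fact_cupExterior F Θ
/-- (Ported verbatim from the HodgeCMPerL package; no docstring in the source.) -/
theorem not_padAlgModel_fact_cupExterior : ¬ padAlgModel.Fact_cupExterior :=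
  PadH6A.not_fact_cupExterior toyModel_modelAxioms toyModel_fact_dimProd toyModel_fact_cupExterior
    toyModel_fact_cup_hodge toyModel_fact_pull_H0 toyModel_fact_hodge_F0
/-- (Ported verbatim from the HodgeCMPerL package; no docstring in the source.) -/
theorem not_padAlgModel_openInputs : ¬ padAlgModel.OpenInputs :=
  PadH6A.not_openInputs toyModel_modelAxioms toyModel_fact_cupExterior

/-- **The truth table of `padAlgModel`.** -/
theorem padAlgModel_profile :
    (padAlgModel.ModelAxioms ∧ padAlgModel.Fact_cup_hodge ∧ padAlgModel.Fact_pull_H0 ∧ padAlgModel.Fact_hodge_F0 ∧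
        padAlgModel.Fact_dimProd ∧ padAlgModel.Fact_cupAssoc ∧ padAlgModel.Fact_cupAlg ∧ padAlgModel.W_RK4 ∧
        padAlgModel.Qw8Sufficiency ∧ padAlgModel.FaceReduction ∧ padAlgModel.HC_CM) ∧
      (¬ padAlgModel.Fact_cupExterior ∧ ¬ padAlgModel.PohlmannSpan ∧ ¬ padAlgModel.OpenInputs) :=
  ⟨⟨padAlgModel_modelAxioms, padAlgModel_fact_cup_hodge, padAlgModel_fact_pull_H0, padAlgModel_fact_hodge_F0,
      padAlgModel_fact_dimProd, padAlgModel_fact_cupAssoc, padAlgModel_fact_cupAlg, padAlgModel_w_rk4,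
      padAlgModel_qw8Sufficiency, padAlgModel_faceReduction, padAlgModel_hc_cm⟩,
    ⟨not_padAlgModel_fact_cupExterior, not_padAlgModel_pohlmannSpan, not_padAlgModel_openInputs⟩⟩


-- port_pkg: scope closed for this part
end Toy
end HodgeCM
end
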